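import Literature.Probability.Process.BrownianBridgeToPoint3
import Literature.Probability.Process.PathSpaceBorel
import Mathlib.Topology.UnitInterval
import Mathlib.Topology.ContinuousMap.Compact
import Mathlib.Topology.MetricSpace.Closeds
import Mathlib.MeasureTheory.Function.StronglyMeasurable.Basic
import HarnessLib

/-!
# The range of the Brownian bridge in `ℝ³` is a random compact set (measurability of the range map)

Topic `Literature/Probability/Process`; everything here is PROVED (no named fact). It discharges
the measurability caveat recorded in `BrownianBridgeToPoint3.lean`: the map
`(ω, t) ↦ bridgeRange t⁺ x y ω` — the range `{X_s : 0 ≤ s ≤ t}` of the Brownian bridge of duration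
`t` from `x` to `y`, a point of the Hausdorff space `NonemptyCompacts ℝ³` with its Borel σ-algebra —
is (jointly) Borel measurable, so that `brownianBridgeToPointRangeLaw3 x y` (the law of the range of
Brownian motion from `x` conditioned to hit `y`, requested for the support statement
`KelvinBridgeCovariance`, item `stmt-CriticalPhenomena-5033`, of the route
`Summit.CriticalPhenomena.Ising3DConformalLimit.Theses.MoebiusRestrictionCurrents`) is the
push-forward of a measurable map and `Measure.map_apply` is available.

The proof factors the range map through path space: `(ω, t) ↦ (u ↦ X_{ut})` is a Borel random
element of `C([0,1], ℝ³)` because each evaluation is measurable (`measurable_continuousMap_of_eval`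
of `PathSpaceBorel`, Billingsley 1999 §7; joint measurability of `(s, ω) ↦ B_s(ω)` from path
continuity), and `f ↦ range f` is `1`-Lipschitz from the uniform to the Hausdorff metric.

* `BrownianBridgeToPoint3.rangeNC`, `lipschitzWith_rangeNC` — the range of `f ∈ C([0,1], ℝ³)` as
  a nonempty compact set, `1`-Lipschitz;
* `BrownianBridgeToPoint3.measurable_uncurry_bm3` — `(s, ω) ↦ B_s(ω)` is jointly measurable;
* `BrownianBridgeToPoint3.bridgePathUnit`, `measurable_bridgePathUnit`, `rangeNC_bridgePathUnit`
  — the bridge reparametrised by `[0,1]`, its measurability as a path-space element, and the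
  identification of its range with `bridgeRange`;
* `measurable_bridgeRange_uncurry`, `measurable_bridgeRange` — the range map is measurable;
* `aemeasurable_bridgeRange_uncurry` — hence a.e.-measurable for the product of the Wiener
  measure with any lifetime law, the form `Measure.map_apply`/`isProbabilityMeasure_map` consume;
* `brownianBridgeToPointRangeLaw3_apply`, `brownianBridgeToPointRangeLaw3_univ` — the law of the
  range evaluated on a Borel set / its total mass (= that of the lifetime law);
* `BrownianBridgeToPoint3.isClosed_setOf_mem` — `{K | z ∈ K}` is closed in the Hausdorff space;
  `brownianBridgeToPointRangeLaw3_compl_setOf_start_mem`, `…_end_mem` — the range contains `x`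
  (surely) and `y` (a.s.: the lifetime law does not charge `t ≤ 0`, `hittingTimeLaw_Iic_zero`).

## References

* P. Billingsley, *Convergence of Probability Measures*, 2nd ed., Wiley (1999), §7 (random
  functions). [Billingsley1999]
* G. Matheron, *Random Sets and Integral Geometry*, Wiley (1975), §1.2 (random closed sets;
  measurability via the hit-or-miss / Hausdorff-metric σ-algebra). [folklore]
-/

noncomputable section

open MeasureTheory TopologicalSpace Set Metric
open scoped NNReal ENNReal unitInterval

namespace Literature.Probability.Process

namespace BrownianBridgeToPoint3

/-! ### The range of a path on the unit interval as a nonempty compact set -/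

/-- The range of a continuous map on the unit interval, as a nonempty compact subset of `ℝ³`.
[folklore] -/
def rangeNC (f : C(I, E3)) : NonemptyCompacts E3 where
  carrier := range f
  isCompact' := isCompact_range f.continuous
  nonempty' := range_nonempty f

/-- The carrier of `rangeNC f` is `range f`. [folklore] -/
@[simp] theorem coe_rangeNC (f : C(I, E3)) : (rangeNC f : Set E3) = range f := rfl

/-- `f ↦ range f` is `1`-Lipschitz from the uniform metric on `C([0,1], ℝ³)` to the Hausdorff
metric on nonempty compact sets. [folklore] -/
theorem lipschitzWith_rangeNC : LipschitzWith 1 rangeNC :=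
  LipschitzWith.mk_one fun f g => by
    rw [NonemptyCompacts.dist_eq, coe_rangeNC, coe_rangeNC]
    refine hausdorffDist_le_of_mem_dist dist_nonneg ?_ ?_
    · rintro _ ⟨u, rfl⟩
      exact ⟨g u, mem_range_self u, ContinuousMap.dist_apply_le_dist u⟩
    · rintro _ ⟨u, rfl⟩
      exact ⟨f u, mem_range_self u, by rw [dist_comm]; exact ContinuousMap.dist_apply_le_dist u⟩

/-- `f ↦ range f` is continuous into the Hausdorff space. [folklore] -/
theorem continuous_rangeNC : Continuous rangeNC := lipschitzWith_rangeNC.continuous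

/-! ### Joint measurability of the driving Brownian motion and of the reparametrised bridge -/

/-- **`(s, ω) ↦ B_s(ω)` is jointly measurable** for the standard Brownian motion `bm3` in `ℝ³`
(paths continuous for every `ω`, marginals measurable). [folklore] -/
theorem measurable_uncurry_bm3 : Measurable fun p : ℝ≥0 × WienerQuad => bm3 p.1 p.2 := by
  have h4 : Measurable (Function.uncurry brownianQuad) :=
    measurable_uncurry_of_continuous_of_measurable (ι := ℝ≥0)
      (fun ω => isBrownianVec_brownianQuad.continuous_path ω) isBrownianVec_brownianQuad.measurable
  unfold bm3
  refine (EuclideanSpace.equiv (Fin 3) ℝ).symm.continuous.measurable.comp ?_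
  exact measurable_pi_lambda _ fun i => (measurable_pi_apply i.succ).comp h4

/-- **The bridge of duration `t⁺` reparametrised by the unit interval**: `u ↦ X_{u t⁺}` for the
bridge path `X = bridgePath t⁺ x y ω` (`t⁺ = max t 0`), an element of `C([0,1], ℝ³)`. [folklore] -/
def bridgePathUnit (x y : E3) (p : WienerQuad × ℝ) : C(I, E3) where
  toFun u := bridgePath p.2.toNNReal x y p.1 ((u : ℝ).toNNReal * p.2.toNNReal)
  continuous_toFun := (continuous_bridgePath _ x y p.1).comp
    ((continuous_real_toNNReal.comp continuous_subtype_val).mul continuous_const)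

/-- Evaluation of the reparametrised bridge. [folklore] -/
theorem bridgePathUnit_apply (x y : E3) (p : WienerQuad × ℝ) (u : I) :
    bridgePathUnit x y p u = bridgePath p.2.toNNReal x y p.1 ((u : ℝ).toNNReal * p.2.toNNReal) :=
  rfl

/-- Each evaluation `(ω, t) ↦ X_{u t⁺}` of the reparametrised bridge is measurable. [folklore] -/
theorem measurable_bridgePathUnit_apply (x y : E3) (u : I) :
    Measurable fun p : WienerQuad × ℝ => bridgePathUnit x y p u := by
  have ht : Measurable fun p : WienerQuad × ℝ => p.2.toNNReal :=
    measurable_real_toNNReal.comp measurable_snd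
  have hs : Measurable fun p : WienerQuad × ℝ => (u : ℝ).toNNReal * p.2.toNNReal :=
    measurable_const.mul ht
  have hr : Measurable fun p : WienerQuad × ℝ =>
      (((u : ℝ).toNNReal * p.2.toNNReal : ℝ≥0) : ℝ) / (p.2.toNNReal : ℝ) :=
    (measurable_coe_nnreal_real.comp hs).div (measurable_coe_nnreal_real.comp ht)
  have hb1 : Measurable fun p : WienerQuad × ℝ => bm3 ((u : ℝ).toNNReal * p.2.toNNReal) p.1 :=
    measurable_uncurry_bm3.comp (hs.prodMk measurable_fst)
  have hb2 : Measurable fun p : WienerQuad × ℝ => bm3 p.2.toNNReal p.1 :=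
    measurable_uncurry_bm3.comp (ht.prodMk measurable_fst)
  simp only [bridgePathUnit_apply, bridgePath]
  exact (measurable_const.add (hr.smul measurable_const)).add (hb1.sub (hr.smul hb2))

/-- **The reparametrised bridge is a Borel random element of path space** `C([0,1], ℝ³)`
(evaluations measurable ⇒ Borel measurable, `measurable_continuousMap_of_eval`).
[cite: Billingsley1999, §7] -/
theorem measurable_bridgePathUnit (x y : E3) :
    Measurable[_, borel C(I, E3)] (bridgePathUnit x y) :=
  measurable_continuousMap_of_eval (measurable_bridgePathUnit_apply x y)

/-- The range of the reparametrised bridge is the range `bridgeRange t⁺ x y ω` of the bridge over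
`[0, t⁺]`. [folklore] -/
theorem rangeNC_bridgePathUnit (x y : E3) (p : WienerQuad × ℝ) :
    rangeNC (bridgePathUnit x y p) = bridgeRange p.2.toNNReal x y p.1 := by
  apply NonemptyCompacts.ext
  rw [coe_rangeNC]
  change range (bridgePathUnit x y p) = bridgePath p.2.toNNReal x y p.1 '' Icc 0 p.2.toNNReal
  set t : ℝ≥0 := p.2.toNNReal with ht
  ext z
  constructor
  · rintro ⟨u, rfl⟩
    refine ⟨(u : ℝ).toNNReal * t, ⟨bot_le, ?_⟩, rfl⟩
    exact mul_le_of_le_one_left bot_le (Real.toNNReal_le_one.2 u.2.2)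
  · rintro ⟨s, ⟨-, hs⟩, rfl⟩
    by_cases h0 : t = 0
    · refine ⟨0, ?_⟩
      have hs0 : s = 0 := le_antisymm (h0 ▸ hs) bot_le
      rw [bridgePathUnit_apply, ← ht, hs0]
      simp
    · have htpos : 0 < (t : ℝ) := NNReal.coe_pos.2 (pos_iff_ne_zero.2 h0)
      have hnn : (0 : ℝ) ≤ (s : ℝ) / t := div_nonneg (NNReal.coe_nonneg s) (NNReal.coe_nonneg t)
      have hst : (s : ℝ) / t ≤ 1 := (div_le_one htpos).2 (NNReal.coe_le_coe.2 hs)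
      refine ⟨⟨(s : ℝ) / t, hnn, hst⟩, ?_⟩
      rw [bridgePathUnit_apply, ← ht]
      congr 1
      change ((s : ℝ) / t).toNNReal * t = s
      apply NNReal.eq
      rw [NNReal.coe_mul, Real.coe_toNNReal _ hnn]
      field_simp

/-! ### Measurability of the range map -/

/-- **The range map `(ω, t) ↦ bridgeRange t⁺ x y ω` is (jointly) Borel measurable** into the
Hausdorff space of nonempty compact subsets of `ℝ³`. [folklore] -/
theorem measurable_bridgeRange_uncurry (x y : E3) :
    Measurable fun p : WienerQuad × ℝ => bridgeRange p.2.toNNReal x y p.1 := by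
  letI : MeasurableSpace C(I, E3) := borel _
  haveI : BorelSpace C(I, E3) := ⟨rfl⟩
  have h : Measurable (rangeNC ∘ bridgePathUnit x y) :=
    continuous_rangeNC.measurable.comp (measurable_bridgePathUnit x y)
  convert h using 1
  funext p
  exact (rangeNC_bridgePathUnit x y p).symm

/-- For a fixed duration `t`, `ω ↦ bridgeRange t x y ω` is Borel measurable. [folklore] -/
theorem measurable_bridgeRange (t : ℝ≥0) (x y : E3) : Measurable (bridgeRange t x y) := by
  have h := (measurable_bridgeRange_uncurry x y).comp
    (measurable_id.prodMk measurable_const : Measurable fun ω : WienerQuad => (ω, (t : ℝ)))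
  simpa [Function.comp_def] using h

/-- The range map is a.e.-measurable for the product of the Wiener measure with any measure on
lifetimes (the form consumed by `Measure.map_apply` for `brownianBridgeToPointRangeLaw3`).
[folklore] -/
theorem aemeasurable_bridgeRange_uncurry (x y : E3) (ν : Measure ℝ) :
    AEMeasurable (fun p : WienerQuad × ℝ => bridgeRange p.2.toNNReal x y p.1) (wienerQuad.prod ν) :=
  (measurable_bridgeRange_uncurry x y).aemeasurable

/-! ### Membership events in the Hausdorff space -/

/-- `{K | z ∈ K}` is closed in the Hausdorff space of nonempty compact sets (`K ↦ infDist z K` is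
`1`-Lipschitz and vanishes exactly when `z ∈ K`). [folklore] -/
theorem isClosed_setOf_mem (z : E3) : IsClosed {K : NonemptyCompacts E3 | z ∈ (K : Set E3)} := by
  have h : {K : NonemptyCompacts E3 | z ∈ (K : Set E3)}
      = (fun K : NonemptyCompacts E3 => infDist z (K : Set E3)) ⁻¹' {0} := by
    ext K
    simp only [mem_setOf_eq, mem_preimage, mem_singleton_iff]
    rw [← mem_closure_iff_infDist_zero K.nonempty, K.isCompact.isClosed.closure_eq]
  rw [h]
  exact isClosed_singleton.preimage (lipschitz_infDist_set z).continuous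

/-- `{K | z ∈ K}` is a Borel set of the Hausdorff space. [folklore] -/
theorem measurableSet_setOf_mem (z : E3) :
    MeasurableSet {K : NonemptyCompacts E3 | z ∈ (K : Set E3)} :=
  (isClosed_setOf_mem z).measurableSet

end BrownianBridgeToPoint3

/-- The lifetime law does not charge nonpositive times. [folklore] -/
theorem hittingTimeLaw_Iic_zero (x y : E3) : hittingTimeLaw x y (Iic 0) = 0 := by
  rw [hittingTimeLaw, withDensity_apply _ measurableSet_Iic,
    Measure.restrict_restrict measurableSet_Iic, Iic_inter_Ioi, Ioc_self, Measure.restrict_empty,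
    lintegral_zero_measure]

/-- The lifetime law is s-finite (a `withDensity` of restricted Lebesgue measure), so that product
and push-forward formulas apply. [folklore] -/
instance sFinite_hittingTimeLaw (x y : E3) : SFinite (hittingTimeLaw x y) := by
  unfold hittingTimeLaw; infer_instance

open BrownianBridgeToPoint3 in
/-- **The law of the range charges a Borel set `𝒜` of compact sets with the product measure of
its preimage**: `brownianBridgeToPointRangeLaw3 x y 𝒜 = (wienerQuad ⊗ hittingTimeLaw x y)
{(ω, t) | bridgeRange t⁺ x y ω ∈ 𝒜}` for `x ≠ y`. [folklore] -/
theorem brownianBridgeToPointRangeLaw3_apply {x y : E3} (h : x ≠ y)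
    {𝒜 : Set (NonemptyCompacts E3)} (h𝒜 : MeasurableSet 𝒜) :
    brownianBridgeToPointRangeLaw3 x y 𝒜 =
      (wienerQuad.prod (hittingTimeLaw x y))
        ((fun p : WienerQuad × ℝ => bridgeRange p.2.toNNReal x y p.1) ⁻¹' 𝒜) := by
  rw [brownianBridgeToPointRangeLaw3_of_ne h,
    Measure.map_apply (measurable_bridgeRange_uncurry x y) h𝒜]

/-- The total mass of the law of the range equals that of the lifetime law (the Wiener measure
being a probability measure); with the Green identity (`hittingTimeLaw x y univ = 1`, file
`BrownianBridgeToPoint3Lifetime`) it is a probability measure. [folklore] -/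
theorem brownianBridgeToPointRangeLaw3_univ {x y : E3} (h : x ≠ y) :
    brownianBridgeToPointRangeLaw3 x y univ = hittingTimeLaw x y univ := by
  rw [brownianBridgeToPointRangeLaw3_apply h MeasurableSet.univ, preimage_univ, ← univ_prod_univ,
    Measure.prod_prod, measure_univ, one_mul]

open BrownianBridgeToPoint3 in
/-- **The range contains the starting point**, surely: the law of the range does not charge
`{K | x ∉ K}` (`x ≠ y`). [folklore] -/
theorem brownianBridgeToPointRangeLaw3_compl_setOf_start_mem {x y : E3} (h : x ≠ y) :
    brownianBridgeToPointRangeLaw3 x y {K | x ∈ (K : Set E3)}ᶜ = 0 := by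
  rw [brownianBridgeToPointRangeLaw3_apply h (measurableSet_setOf_mem x).compl]
  convert measure_empty (μ := wienerQuad.prod (hittingTimeLaw x y)) using 2
  ext p
  simp only [preimage_compl, mem_compl_iff, mem_preimage, mem_setOf_eq, mem_empty_iff_false,
    iff_false, not_not]
  exact start_mem_bridgeRange _ x y p.1

open BrownianBridgeToPoint3 in
/-- **The range contains the end point**, almost surely: the law of the range does not charge
`{K | y ∉ K}` (`x ≠ y`; the exceptional set is `{lifetime ≤ 0}`, null for the lifetime law).
[folklore] -/
theorem brownianBridgeToPointRangeLaw3_compl_setOf_end_mem {x y : E3} (h : x ≠ y) :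
    brownianBridgeToPointRangeLaw3 x y {K | y ∈ (K : Set E3)}ᶜ = 0 := by
  rw [brownianBridgeToPointRangeLaw3_apply h (measurableSet_setOf_mem y).compl]
  refine measure_mono_null (t := (univ : Set WienerQuad) ×ˢ Iic (0 : ℝ)) (fun p hp => ?_) ?_
  · simp only [preimage_compl, mem_compl_iff, mem_preimage, mem_setOf_eq] at hp
    refine ⟨mem_univ _, ?_⟩
    by_contra hpos
    simp only [mem_Iic, not_le] at hpos
    exact hp (end_mem_bridgeRange (by simpa using hpos) x y p.1)
  · rw [Measure.prod_prod, hittingTimeLaw_Iic_zero, mul_zero]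

end Literature.Probability.Process
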